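import Summits.HodgeConjecture.HodgeConjecture.Theorems.HolomorphicityRateThresholdForcesHodgeTypeLine
import Literature.AlgebraicGeometry.HodgeTheory.SupportedClassesRationalProofs
import Literature.Geometry.Kaehler.NearlyHolomorphicCycleSupport
import HarnessLib

/-!
# Route HolomorphicityRate — crux `SuperThresholdRigidity` (stmt-HodgeConjecture-2737), stub A:
# the rational Thom line of a nearly holomorphic cycle support

Registered stub `stub_rationalThomLine` of the skeleton `Cruxes/SuperThresholdRigidity/Lines/birth.lean`
(line `registered`), signature verbatim. For `X` smooth projective of dimension `n` over `ℂ`, a Hodge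
model `A` (`A.carrier = X^an`), a smooth metric `g` on `X^an`, `p ≥ 1` and a nearly holomorphic
cycle support `(S, Sg)` of codimension `p` with any defect `t`, the kernel
`K = {γ ∈ H²ᵖ(X(ℂ); ℂ) | (A^* γ)|_{X^an ∖ S} = 0}` is a line spanned by a RATIONAL class `r ∈ K`
("`H²ᵖ_S(X^an) = ℂ · [S]` with `[S]` a rational class", Voisin I, §11.1.2 Lemma 11.13 with §7.1.1).

Assembly of two proved theorems of the tree:

* `Summit.HodgeConjecture.HodgeConjecture.Theorems.holomorphicityRate_supportedClasses_le_span` —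
  `K` lies on a line `ℂ · τ` (Thom isomorphism off the bad set, analytic semipurity, Kronecker
  duality; file `HolomorphicityRateThresholdForcesHodgeTypeLine`);
* `Literature.AlgebraicGeometry.HodgeTheory.mem_span_isRationalClass_of_map_eq_zero` with the
  discharged fact `span_isRationalClass_eq_top_of_isSmoothProjective_holds` — rational descent of
  kernels of pull-back maps: a class of `H²ᵖ(X(ℂ); ℂ)` killed by `f^*` for the continuous map
  `f : X^an ∖ S → X^an → X(ℂ)` is a complex combination of RATIONAL classes killed by `f^*`
  (`ker (f^* ⊗ ℂ) = (ker f^*) ⊗ ℂ`, Hatcher §3.1), after rewriting `(A^* γ)|_{X^an ∖ S} = f^* γ`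
  by contravariant functoriality `singularCohomology.map_comp`.

So either `K = 0` (take `r = 0`, `IsRationalClass.zero`) or `K` contains a non-zero rational class
`r`, and then every `γ ∈ K ⊆ ℂ · τ` is a complex multiple of `r` (one-dimensional bookkeeping,
`exists_smul_eq_of_mem_span_singleton`).

## References

* C. Voisin, *Hodge Theory and Complex Algebraic Geometry I* (2002), §11.1.2 Lemma 11.13, §7.1.1.
  [VoisinHodgeI2002]
* A. Hatcher, *Algebraic Topology* (2002), §3.1 p. 198. [HatcherAT2002]
-/

-- `Summit.HodgeConjecture.HodgeConjecture.Theorems` is the mandated namespace (single-problem summit: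
-- Problem = Summit), which `linter.dupNamespace` flags on every declaration; the lakefile turns the
-- linter off tree-wide (weak option), restated here so stand-alone elaboration is warning-free too.
set_option linter.dupNamespace false

noncomputable section

namespace Summit.HodgeConjecture.HodgeConjecture.Theorems

open scoped Manifold ContDiff Topology
open Literature.AlgebraicGeometry.HodgeTheory Literature.AlgebraicGeometry.Motives
  Literature.AlgebraicTopology.SingularHomology Literature.Geometry.Kaehler

/-- One-dimensional bookkeeping: if `r ≠ 0` and `γ` both lie on the line `F · τ`, then `γ` is a
multiple of `r` (`r = b • τ` with `b ≠ 0`, `γ = a • τ = (a / b) • r`). [folklore] -/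
theorem exists_smul_eq_of_mem_span_singleton {F : Type*} [Field F] {V : Type*} [AddCommGroup V]
    [Module F V] {τ r γ : V} (hr : r ∈ Submodule.span F ({τ} : Set V)) (hr0 : r ≠ 0)
    (hγ : γ ∈ Submodule.span F ({τ} : Set V)) : ∃ e : F, γ = e • r := by
  obtain ⟨b, hb⟩ := Submodule.mem_span_singleton.1 hr
  obtain ⟨a, ha⟩ := Submodule.mem_span_singleton.1 hγ
  have hb0 : b ≠ 0 := by
    rintro rfl
    rw [zero_smul] at hb
    exact hr0 hb.symm
  refine ⟨a / b, ?_⟩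
  rw [← hb, smul_smul, div_mul_cancel₀ a hb0, ha]

/-- **The pull-back to a Hodge model restricted off `S` is the pull-back along one continuous map.**
For a Hodge model `A` of `X` with comparison map `φ : X^an → X(ℂ)` and `S ⊆ X^an`:
`(A^* γ)|_{X^an ∖ S} = (φ ∘ incl)^* γ` for the inclusion `incl : X^an ∖ S ↪ X^an` (contravariant
functoriality of singular cohomology). [cite: HatcherAT2002, §3.1 p. 198] -/
theorem map_compl_pullback_eq_map_comp {n : ℕ} {X : SchemeOver ℂ} (A : HodgeModel n X)
    (S : Set A.carrier) (k : ℕ) (γ : complexBetti X k) :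
    singularCohomology.map ℂ ℂ
        (⟨Subtype.val, continuous_subtype_val⟩ : C({x : A.carrier // x ∉ S}, A.carrier)) k
        (A.pullback k γ) =
      singularCohomology.map ℂ ℂ
        ((⟨A.toComplexPoints, A.isAnalytification.isHomeomorph.continuous⟩ :
            C(A.carrier, ComplexPoints X)).comp
          (⟨Subtype.val, continuous_subtype_val⟩ : C({x : A.carrier // x ∉ S}, A.carrier))) k γ := by
  rw [singularCohomology.map_comp, ModuleCat.comp_apply]

/-- **Stub A of crux `SuperThresholdRigidity` — the rational Thom line of a nearly holomorphic cycle
support.** For `X` smooth projective of dimension `n`, a Hodge model `A` (`A.carrier = X^an`), a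
smooth metric `g`, `p ≥ 1` and a nearly holomorphic cycle support `(S, Sg)` of codimension `p` and
any defect `t` (`Literature.Geometry.Kaehler.IsNearlyHolomorphicCycleSupport g.toRiemannianMetric p t S Sg`),
there is a RATIONAL class `r ∈ H²ᵖ(X(ℂ); ℂ)` whose pull-back dies off `S` such that every class whose
pull-back dies off `S` is a complex multiple of `r` ("`H²ᵖ_S(X^an) = ℂ · [S]` with `[S]` rational").
Proof: the kernel `K` of `γ ↦ (A^* γ)|_{X^an ∖ S}` lies on a line `ℂ · τ`
(`holomorphicityRate_supportedClasses_le_span`); every class of `H²ᵖ(X(ℂ); ℂ)` is a complex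
combination of rational classes (`span_isRationalClass_eq_top_of_isSmoothProjective_holds`), so by
rational descent along the continuous map `X^an ∖ S → X(ℂ)`
(`mem_span_isRationalClass_of_map_eq_zero`, `map_compl_pullback_eq_map_comp`) `K` is spanned by its
rational members; if `K = 0` take `r = 0` (`IsRationalClass.zero`), else a non-zero rational `r ∈ K`
spans the line (`exists_smul_eq_of_mem_span_singleton`).
[cite: VoisinHodgeI2002, §11.1.2 Lemma 11.13 and §7.1.1] [cite: HatcherAT2002, §3.1 p. 198] -/
theorem stub_rationalThomLine : ∀ (n : ℕ) (X : Literature.AlgebraicGeometry.Motives.SchemeOver ℂ), Literature.AlgebraicGeometry.Motives.IsSmoothProjective n X → ∀ (A : Literature.AlgebraicGeometry.HodgeTheory.HodgeModel n X) (g : Bundle.ContMDiffRiemannianMetric 𝓘(ℝ, A.model) ((⊤ : ℕ∞) : WithTop ℕ∞) A.model (fun x : A.carrier => TangentSpace 𝓘(ℝ, A.model) x)) (p : ℕ) (t : ℝ) (S Sg : Set A.carrier), 0 < p → Literature.Geometry.Kaehler.IsNearlyHolomorphicCycleSupport g.toRiemannianMetric p t S Sg → ∃ r : Literature.AlgebraicGeometry.HodgeTheory.complexBetti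 X (2 * p), Literature.AlgebraicGeometry.HodgeTheory.IsRationalClass r ∧ Literature.AlgebraicTopology.SingularHomology.singularCohomology.map ℂ ℂ (⟨Subtype.val, continuous_subtype_val⟩ : C({x : A.carrier // x ∉ S}, A.carrier)) (2 * p) (A.pullback (2 * p) r) = 0 ∧ ∀ γ : Literature.AlgebraicGeometry.HodgeTheory.complexBetti X (2 * p), Literature.AlgebraicTopology.SingularHomology.singularCohomology.map ℂ ℂ (⟨Subtype.val, continuous_subtype_val⟩ : C({x : A.carrier // x ∉ S}, A.carrier)) (2 * p) (A.pullback (2 * p) γ) = 0 → ∃ e : ℂ, γ = e • r := by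
  intro n X hX A g p t S Sg hp hS
  -- the kernel lies on a line `ℂ · τ`
  obtain ⟨τ, hτ⟩ := holomorphicityRate_supportedClasses_le_span A g hp hS
  -- the single continuous map `f = φ ∘ incl : X^an ∖ S → X(ℂ)` computing `(A^* γ)|_{X^an ∖ S}`
  set f : C({x : A.carrier // x ∉ S}, ComplexPoints X) :=
    ((⟨A.toComplexPoints, A.isAnalytification.isHomeomorph.continuous⟩ :
        C(A.carrier, ComplexPoints X)).comp
      (⟨Subtype.val, continuous_subtype_val⟩ : C({x : A.carrier // x ∉ S}, A.carrier)))
  have hkey : ∀ γ : complexBetti X (2 * p),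
      singularCohomology.map ℂ ℂ
          (⟨Subtype.val, continuous_subtype_val⟩ : C({x : A.carrier // x ∉ S}, A.carrier)) (2 * p)
          (A.pullback (2 * p) γ) =
        singularCohomology.map ℂ ℂ f (2 * p) γ :=
    fun γ => map_compl_pullback_eq_map_comp A S (2 * p) γ
  by_cases h : ∃ γ₀ : complexBetti X (2 * p),
      singularCohomology.map ℂ ℂ
          (⟨Subtype.val, continuous_subtype_val⟩ : C({x : A.carrier // x ∉ S}, A.carrier)) (2 * p)
          (A.pullback (2 * p) γ₀) = 0 ∧ γ₀ ≠ 0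
  · -- `K ≠ 0`: a non-zero `γ₀ ∈ K` is a complex combination of RATIONAL classes of `K`, so one of
    -- them, `r`, is non-zero; `r` spans the line
    obtain ⟨γ₀, hγ₀, hγ₀0⟩ := h
    have hmem : γ₀ ∈ Submodule.span ℂ {x : complexBetti X (2 * p) |
        IsRationalClass x ∧ singularCohomology.map ℂ ℂ f (2 * p) x = 0} :=
      mem_span_isRationalClass_of_map_eq_zero f
        (span_isRationalClass_eq_top_of_isSmoothProjective_holds.mem_span hX γ₀)
        (by rw [← hkey]; exact hγ₀)
    obtain ⟨r, hrat, hr, hr0⟩ : ∃ r : complexBetti X (2 * p),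
        IsRationalClass r ∧ singularCohomology.map ℂ ℂ f (2 * p) r = 0 ∧ r ≠ 0 := by
      by_contra hcon
      have hbot : Submodule.span ℂ {x : complexBetti X (2 * p) |
          IsRationalClass x ∧ singularCohomology.map ℂ ℂ f (2 * p) x = 0} = ⊥ :=
        Submodule.span_eq_bot.2 fun c hc => by_contra fun h0 => hcon ⟨c, hc.1, hc.2, h0⟩
      rw [hbot, Submodule.mem_bot] at hmem
      exact hγ₀0 hmem
    have hrK : singularCohomology.map ℂ ℂ
        (⟨Subtype.val, continuous_subtype_val⟩ : C({x : A.carrier // x ∉ S}, A.carrier)) (2 * p)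
        (A.pullback (2 * p) r) = 0 := by
      rw [hkey]
      exact hr
    exact ⟨r, hrat, hrK, fun γ hγ =>
      exists_smul_eq_of_mem_span_singleton (hτ r hrK) hr0 (hτ γ hγ)⟩
  · -- `K = 0`: the zero class serves
    refine ⟨0, IsRationalClass.zero, by rw [map_zero, map_zero], fun γ hγ => ⟨0, ?_⟩⟩
    rw [smul_zero]
    by_contra h0
    exact h ⟨γ, hγ, h0⟩

end Summit.HodgeConjecture.HodgeConjecture.Theorems

end
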